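import Summits.SmoothPoincare4.SmoothPoincare4.Theorems.ConvexBisectionAcyclicBisectionRigiditySeamGluing
import Summits.SmoothPoincare4.SmoothPoincare4.Theorems.ConvexBisectionContractibleTwistedDoubleStandardStubSeam
import Literature.Geometry.Symplectic.SteinBoundaryContactProofs
import Literature.Topology.FourManifolds.Handles
import Literature.Topology.FourManifolds.HomotopyS4CompactProofs
import HarnessLib

/-!
# Seam gluing of Morse functions, VI: the glued Morse profile of a Stein bisection

Helper file (lead c1, crux `ConvexBisection.AcyclicBisectionRigidity`, item
stmt-SmoothPoincare4-10507).  The typed packaging step shared by the two round-2 cross-seam levers,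
now a THEOREM over the crux's own vocabulary:

* `exists_isMorse_of_steinBisection_of_hasHandleDecomposition` — let `M ≃ₕ S⁴` be a Hausdorff
  second-countable smooth 4-manifold bisected along a common contact seam by two compact Stein
  domains `(W₁, J₁)`, `(W₂, J₂)` (the hypothesis of the crux, without the acyclicity conjunct), and
  suppose the halves carry handle decompositions with `c₁ k`, resp. `c₂ k`, handles of index `k`
  (`HasHandleDecomposition 3 Wᵢ cᵢ`).  Then `M` carries a Morse function with exactly
  `c₁ i + c₂ j` critical points of index `i` whenever `i + j = 4` — the glued handle structure
  `[h⁰ ∪ … ]_{W₁} ∪ [ … ∪ h⁴]_{W̄₂}` read from `W₁`'s side.  Instances: both halves Mazur-type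
  `(1,1,1)` ⇒ profile `(1, 1, 2, 1, 1)` (the setting of `stub_seamPairDichotomy`); balanced
  2-handlebodies `h⁰ ∪ nᵢ h¹ ∪ nᵢ h²` ⇒ profile `(1; n₁; n₁ + n₂; n₂; 1)` (the setting of
  `stub_crossCancellation`).

Ingredients: the seam diffeomorphism `ψ : ∂W₁ ≅ ∂W₂` of the landed `LegendrianRKnotRigidity.stub_seam`
(crux 4), the bisection-to-gluing dictionary and the Morse gluing across the seam of
`SeamGluing.exists_isMorse_of_bisection`.  Everything is proved; no definitions. [folklore]
-/

noncomputable section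

open scoped Manifold ContDiff Topology ContinuousMap
open Set Function Filter Literature.Topology.FourManifolds Literature.Geometry.Symplectic

-- the prescribed namespace `Summit.<P>.<Sub>.…` duplicates `SmoothPoincare4` (P = Sub)
set_option linter.dupNamespace false

namespace Summit.SmoothPoincare4.SmoothPoincare4.Theorems.AcyclicBisectionRigidity.SeamGluing

/-- **In a Stein bisection of a nonempty manifold the first half has nonempty boundary**: if
`∂W₁ = ∅` the seam `e₁(∂W₁) = range e₁ ∩ range e₂` is empty, so the second half is all of `M` or
empty — in the first case a compact nonempty Stein domain all of whose boundary points are cut out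
by the seam equation `range e₁ ∩ range e₂ = e₂(∂W₂)`, in the second `W₁` is a nonempty compact
Stein domain; either way `SteinStructure.exists_isBoundaryPoint` produces a contradiction. [folklore] -/
theorem boundary_nonempty_of_steinBisection {M : Type} [Nonempty M]
    {W₁ : Type} [TopologicalSpace W₁] [ChartedSpace (EuclideanHalfSpace 4) W₁] [IsManifold (𝓡∂ 4) ∞ W₁]
    [CompactSpace W₁] {W₂ : Type} [TopologicalSpace W₂] [ChartedSpace (EuclideanHalfSpace 4) W₂]
    [IsManifold (𝓡∂ 4) ∞ W₂] [CompactSpace W₂] (J₁ : SteinStructure W₁) (J₂ : SteinStructure W₂)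
    {e₁ : W₁ → M} {e₂ : W₂ → M} (hcover : range e₁ ∪ range e₂ = univ)
    (hseam₁ : range e₁ ∩ range e₂ = e₁ '' (𝓡∂ 4).boundary W₁)
    (hseam₂ : range e₁ ∩ range e₂ = e₂ '' (𝓡∂ 4).boundary W₂) :
    ((𝓡∂ 4).boundary W₁).Nonempty := by
  by_contra h
  rw [not_nonempty_iff_eq_empty] at h
  have hseam : range e₁ ∩ range e₂ = ∅ := by rw [hseam₁, h, image_empty]
  have hb₂ : (𝓡∂ 4).boundary W₂ = ∅ := by
    have : e₂ '' (𝓡∂ 4).boundary W₂ = ∅ := by rw [← hseam₂, hseam]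
    exact image_eq_empty.1 this
  rcases isEmpty_or_nonempty W₁ with hW₁ | hW₁
  · -- `W₂` covers `M`, hence is nonempty, Stein, without boundary points
    have hr₁ : range e₁ = ∅ := range_eq_empty e₁
    have hW₂ : Nonempty W₂ := by
      obtain ⟨m⟩ := ‹Nonempty M›
      have hm : m ∈ range e₁ ∪ range e₂ := by rw [hcover]; exact mem_univ m
      rw [hr₁, empty_union] at hm
      obtain ⟨w, -⟩ := hm
      exact ⟨w⟩
    obtain ⟨x, hx⟩ := J₂.exists_isBoundaryPoint
    have : x ∈ (𝓡∂ 4).boundary W₂ := hx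
    rw [hb₂] at this
    exact this
  · obtain ⟨x, hx⟩ := J₁.exists_isBoundaryPoint
    have : x ∈ (𝓡∂ 4).boundary W₁ := hx
    rw [h] at this
    exact this

/-- **The glued Morse profile of a common-contact Stein bisection with handle decompositions of
the halves.**  For `M ≃ₕ S⁴` bisected along a common contact seam by compact Stein domains
`(W₁, J₁)`, `(W₂, J₂)` with handle decompositions `HasHandleDecomposition 3 Wᵢ cᵢ`, there is a
Morse function on `M` with `#Crit_i = c₁ i + c₂ j` for `i + j = 4` (seam diffeomorphism from
`LegendrianRKnotRigidity.stub_seam`, then `exists_isMorse_of_bisection`). This is the typed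
packaging step "(L)" of `stub_seamPairDichotomy` (Mazur–Mazur halves: profile `(1,1,2,1,1)`) and the
first step of `stub_crossCancellation` (balanced halves: `(1; n₁; n₁+n₂; n₂; 1)`); the levers' content
— cancelling the middle handles across the seam — starts from this function.
[cite: MilnorHCobordism1965, §1 and proof of Thm. 3.4] -/
theorem exists_isMorse_of_steinBisection_of_hasHandleDecomposition
    (M : Type) [TopologicalSpace M] [T2Space M] [SecondCountableTopology M]
    [ChartedSpace (EuclideanSpace ℝ (Fin 4)) M] [IsManifold (𝓡 4) ∞ M]
    (hM : M ≃ₕ (Metric.sphere (0 : EuclideanSpace ℝ (Fin 5)) 1))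
    (W₁ : Type) [TopologicalSpace W₁] [ChartedSpace (EuclideanHalfSpace 4) W₁] [IsManifold (𝓡∂ 4) ∞ W₁]
    [CompactSpace W₁] (W₂ : Type) [TopologicalSpace W₂] [ChartedSpace (EuclideanHalfSpace 4) W₂]
    [IsManifold (𝓡∂ 4) ∞ W₂] [CompactSpace W₂] (J₁ : SteinStructure W₁) (J₂ : SteinStructure W₂)
    (e₁ : W₁ → M) (e₂ : W₂ → M)
    (he₁ : Manifold.IsSmoothEmbedding (𝓡∂ 4) (𝓡 4) ∞ e₁)
    (he₂ : Manifold.IsSmoothEmbedding (𝓡∂ 4) (𝓡 4) ∞ e₂)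
    (hcover : range e₁ ∪ range e₂ = univ)
    (hseam₁ : range e₁ ∩ range e₂ = e₁ '' (𝓡∂ 4).boundary W₁)
    (hseam₂ : range e₁ ∩ range e₂ = e₂ '' (𝓡∂ 4).boundary W₂)
    (hξ : ∀ w₁ w₂, e₁ w₁ = e₂ w₂ →
      Submodule.map (mfderiv (𝓡∂ 4) (𝓡 4) e₁ w₁).toLinearMap (contactPlane J₁.J w₁) =
      Submodule.map (mfderiv (𝓡∂ 4) (𝓡 4) e₂ w₂).toLinearMap (contactPlane J₂.J w₂))
    {c₁ c₂ : ℕ → ℕ} (h₁ : HasHandleDecomposition 3 W₁ c₁) (h₂ : HasHandleDecomposition 3 W₂ c₂) :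
    ∃ F : M → ℝ, IsMorse (𝓡 4) F ∧
      ∀ i j : ℕ, i + j = 4 → (criticalSetOfIndex (𝓡 4) F i).ncard = c₁ i + c₂ j := by
  -- `M` is compact and nonempty; the halves are Hausdorff and second countable
  haveI : CompactSpace M := compactSpace_of_homotopyEquiv_sphere_four_holds M hM
  haveI : Nonempty M := ⟨hM.invFun ⟨EuclideanSpace.single 0 1, by simp⟩⟩
  haveI : T2Space W₁ := he₁.isEmbedding.t2Space
  haveI : T2Space W₂ := he₂.isEmbedding.t2Space
  haveI : SecondCountableTopology W₁ := he₁.isEmbedding.secondCountableTopology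
  haveI : SecondCountableTopology W₂ := he₂.isEmbedding.secondCountableTopology
  -- boundary data and the seam diffeomorphism (crux 4's landed `stub_seam`)
  obtain ⟨b₁⟩ : Nonempty (BoundaryData (𝓡∂ 4) W₁ (𝓡 3)) := nonempty_boundaryData_holds 3 W₁
  obtain ⟨b₂⟩ : Nonempty (BoundaryData (𝓡∂ 4) W₂ (𝓡 3)) := nonempty_boundaryData_holds 3 W₂
  obtain ⟨ψ, hψ, -⟩ :=
    ContractibleTwistedDoubleStandard.LegendrianRKnotRigidity.stub_seam M W₁ W₂ J₁ J₂ e₁ e₂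
      he₁ he₂ hseam₁ hseam₂ hξ b₁ b₂
  -- `∂W₁ ≠ ∅`
  haveI : Nonempty b₁.carrier := by
    obtain ⟨x, hx⟩ := boundary_nonempty_of_steinBisection J₁ J₂ hcover hseam₁ hseam₂
    rw [← b₁.range_incl] at hx
    obtain ⟨z, -⟩ := hx
    exact ⟨z⟩
  -- the adapted Morse functions of the two handle decompositions, glued across the seam
  obtain ⟨f₁, hf₁, hc₁⟩ := h₁
  obtain ⟨f₂, hf₂, hc₂⟩ := h₂
  obtain ⟨F, hF, hcount⟩ := exists_isMorse_of_bisection he₁ he₂ hcover hseam₁ b₁ b₂ ψ hψ hf₁ hf₂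
  refine ⟨F, hF, fun i j hij => ?_⟩
  rw [hcount i j hij, hc₁ i, hc₂ j]

end Summit.SmoothPoincare4.SmoothPoincare4.Theorems.AcyclicBisectionRigidity.SeamGluing

end
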